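import Summits.CriticalPhenomena.PercolationContinuityZ3.Theorems.Transplant.SkelPhiStepIFrQ
import Summits.CriticalPhenomena.PercolationContinuityZ3.Theorems.Transplant.SkelPhiEquilibriumBQQ
import Summits.CriticalPhenomena.PercolationContinuityZ3.Theorems.Transplant.SkelPhiInfClusterMeetsEqQ
import Summits.CriticalPhenomena.PercolationContinuityZ3.Theorems.Transplant.SkelPhiQStepsNMaps
import HarnessLib

/-!
# WAVE-Q binder row Q28 («SkelPhiStepIFrQ» ↦ «SkelPhiStepIFrQQ»): the thresholds lemma and STEP I‴ WITH ORIENTATION AND PREFERRED QUADRANT, `Skelφ.StepI.exists_thresholds_of_seedQ` /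
# `Skelφ.StepI.exists_stepI_frQ`, re-typed under EXACT-FOOTPRINT QUASI-STEPS — `(hst : Skelφ.Steps G ψ) ↦ {N : ℕ} (hq : Skelφ.QStepsN G ψ N)`; sentences otherwise token for token
# the twins' (the step hypothesis is only THREADED: into `meetsAS_compl_XinfQ/stripQ` (stmt-g33's «SkelPhiInfClusterMeetsEqQ» p511397), `Eq.exists_equilibriumWBQ_q` (Q15
# «SkelPhiEquilibriumBQQ»), and the transpose `QStepsN.trφ` (gen-1's «SkelPhiQStepsNMaps» p504935))

builds on p205010 (kernel theorem, internal audit signed; external expert review pending) — nothing here uses p205010; nothing is claimed about any open node; no definition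
(`sgnU`, `famSign`, `eqQuintBQ`, `DataN`, … are the twin's, imported).  Lane `prim-bschramm`, seat `prim-bschramm-p3` gen 29 (design owner, porting in the binder wave under
the captain gen-1 g4; WAVE-Q-BINDER-rows-v0.6.tsv row Q28).  Helper file (`--supports stmt-CriticalPhenomena-4575 --as helper`).  Regression: at `N = 1` the hypothesis is
supplied by `Skelφ.qStepsN_of_steps` and the statements are the twins'.
[cite: MartineauTassion2017, §3.2 Lemma 3.5, §3.3 Lemma 3.7] [cite: KozmaNitzan2024, §4 p. 17 (Step I)] [this work]
-/

noncomputable section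

namespace Summit.CriticalPhenomena.PercolationContinuityZ3.Theorems.Transplant

namespace Skelφ

open MeasureTheory ProbabilityTheory Filter Topology Literature.Probability.Percolation Literature.Probability.LatticeModels SimpleGraph KNLevels
open Literature.Barriers.CriticalPhenomena (graphBall)
open scoped Classical

variable {V : Type} {G : SimpleGraph V} {φ : V → Site 2}

namespace StepI

/-- **Thresholds for a dictionary map `ψ ∈ {φ, φᵀ}` over `φ`'s fat seed and fat radius, FRAMES-ONLY**: the sentence of `exists_thresholds_of_seedO` without `ρ`, output
`EquilibriumAtWBQ`. [cite: MartineauTassion2017, §3.2 Lemma 3.5] -/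
theorem exists_thresholds_of_seedQ_q [Countable V] [G.LocallyFinite] {types : Finset V} (hc : G.Preconnected) {ψ : V → Site 2} (hlip : Lip G ψ) {N : ℕ} (hq : QStepsN G ψ N)
    (hfrψ : Frames G ψ types) (hfr : Frames G φ types) {p : unitInterval} (hCψ : CylSubcritical G ψ types p) (hC : CylSubcritical G φ types p)
    (hcyl : ∀ t n, cyl ψ t n = cyl φ t n) (hball : ∀ t n R, cylBall G ψ t n R = cylBall G φ t n R)
    (hreach : ∀ t n R a, cylReach G ψ t n R a = cylReach G φ t n R a) (hp0 : 0 < (p : ℝ)) (hp1 : (p : ℝ) < 1)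
    (hU : ∀ᵐ ω ∂bondPercolation G p, numInfiniteClusters ω ≤ 1) {t : V} (ht : t ∈ types) {ε : ℝ} (hε0 : 0 < ε) (hε1 : ε < 1) {k : ℕ} (hk1 : 1 ≤ k)
    (hseed : 1 - (ε / 2) ^ 32 ≤ (bondPercolation G p).real (TwoAxis.SeedPerc (↑(fatSeq hfr hC t k) : Set V))) :
    ∃ (M₀ : ℕ) (n₁ : ℕ → ℕ), k ≤ M₀ ∧ ∀ M, M₀ ≤ M → ∀ n, n₁ M ≤ n → ¬ Eq.Good G ψ t p ↑(fatSeq hfr hC t k) n 0 (3 * n) →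
      EquilibriumAtWBQ G ψ p t (fatSeq hfr hC t k) M (fatRadius hfr hC) ε n := by
  set μ := bondPercolation G p with hμ
  have hε2 : 0 < ε / 2 := by positivity
  have hε21 : ε / 2 < 1 := by linarith
  obtain ⟨m, hm⟩ := exists_pow_lt_of_lt_one hε2 (show (1 / 2 : ℝ) < 1 by norm_num)
  set M₀ : ℕ := max (k + 1) m with hM₀
  have key : ∀ M, ∃ n₁ : ℕ, M₀ ≤ M → ∀ n, n₁ ≤ n → ¬ Eq.Good G ψ t p ↑(fatSeq hfr hC t k) n 0 (3 * n) →
      EquilibriumAtWBQ G ψ p t (fatSeq hfr hC t k) M (fatRadius hfr hC) ε n := by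
    intro M
    by_cases hM : M₀ ≤ M
    swap
    · exact ⟨0, fun h => absurd h hM⟩
    have hkM : k + 1 ≤ M := le_trans (le_max_left _ _) hM
    have hmM : m ≤ M := le_trans (le_max_right _ _) hM
    have hSM : (↑(fatSeq hfr hC t k) : Set V) ⊆ cyl ψ t M := by
      rw [hcyl]; exact (fatSeq_subset_cyl hfr hC t k).trans (cyl_mono φ t (by omega))
    have hQx : ∀ σu : ℤˣ, Eq.MeetsAS G p (Eq.Xinf ψ t (σu : ℤ) (M + 3))ᶜ := fun σu =>
      meetsAS_compl_XinfQ hc hfrψ hq hlip hU t (by rcases Int.units_eq_one_or σu with h | h <;> simp [h]) (M + 3)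
    have htail : ∀ L, M ≤ L → μ.real (⋃ b ∈ fatSeq hfr hC t k, cylReach G ψ t L (fatRadius hfr hC L - 1) b) ≤ ε / 2 := by
      intro L hL
      have h1 := real_biUnion_cylReach_fat_le hfr hC ht (n := L) (by omega) (Eq.fatSeq_subset_fatSeq hfr hC t (show k ≤ L - 1 by omega))
      have h2 : (1 / 2 : ℝ) ^ L ≤ (1 / 2) ^ m := pow_le_pow_of_le_one (by norm_num) (by norm_num) (by omega)
      simp only [hreach]
      linarith
    obtain ⟨n₁, hn₁⟩ := Eq.exists_equilibriumWBQ_q (t := t) hlip hq hfrψ hCψ hp0 hp1 (M := M) (by omega) (fatSeq hfr hC t k)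
      ((mem_fatSeq_iff hfr hC).2 (self_mem_cylBall G φ t k _)) hSM
      (fun n => meetsAS_compl_stripQ hc hfrψ hq hlip hU t n) hQx hε2 hε21 hseed (fatRadius hfr hC)
      (fun L hL => le_trans (by omega) (le_fatRadius hfr hC L))
      (fun L hL v hv => by
        rw [hball]; exact cylBall_mono G φ t (by omega) (fatRadius_mono hfr hC (by omega)) ((mem_fatSeq_iff hfr hC).1 (Finset.mem_coe.1 hv)))
      htail
    refine ⟨n₁, fun _ n hn hng => ?_⟩
    have := hn₁ n hn hng
    rwa [add_halves] at this
  choose n₁ hn₁ using key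
  exact ⟨M₀, n₁, le_trans (Nat.le_succ _) (le_max_left _ _), fun M hM n hn => hn₁ M hM n hn⟩

/-- **STEP I‴ (frames-only) WITH ORIENTATION AND PREFERRED QUADRANT.** As `exists_stepI_negO` but with NO point symmetry: outputs the two records `D` (for `φ`), `DT`
(for `trφ φ`), the orientation bit `ori`, and the preferred quadrants `qd`, `qdT`; at every admissible `(t, M, n)` the record of the chosen orientation satisfies the
geometric clause, the shear bound `|h| ≤ 10n`, and has its FOUR piece-links at the preferred signs likely.
[cite: MartineauTassion2017, §3.3 Lemma 3.7] [cite: KozmaNitzan2024, §4 p. 17 (Step I)] [this work] -/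
theorem exists_stepI_frQ_q [Countable V] [G.LocallyFinite] {types : Finset V} (hc : G.Preconnected) (hlip : Lip G φ) {N : ℕ} (hq : QStepsN G φ N)
    (hfr : Frames G φ types) (hκ : CylConn G φ types) {p : unitInterval} (hC : CylSubcritical G φ types p) (hp0 : 0 < (p : ℝ)) (hp1 : (p : ℝ) < 1)
    (hU : ∀ᵐ ω ∂bondPercolation G p, numInfiniteClusters ω ≤ 1) {z : V} (hθ : 0 < theta G z p) {δ : ℝ} (hδ0 : 0 < δ) (hδ1 : δ < 1) (m₀ : ℕ) :
    ∃ (D DT : DataN V) (qd qdT : V → ℕ → ℕ → ℤˣ × ℤˣ) (ori : V → ℕ → ℕ → Bool),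
      m₀ ≤ D.k ∧ 1 ≤ D.k ∧ D.k ≤ D.M₀ ∧ D.R = fatRadius hfr hC ∧ D.Λ = fatSeq hfr hC ∧
      DT.Λ = D.Λ ∧ DT.k = D.k ∧ DT.R = D.R ∧ DT.M₀ = D.M₀ ∧ DT.n₁ = D.n₁ ∧
      (∀ t ∈ types, ∀ M, D.M₀ ≤ M → 1 - δ < (bondPercolation G p).real (eventN G φ D (t, M, none))) ∧
      (∀ t ∈ types, ∀ M, D.M₀ ≤ M → ∀ n, D.n₁ M ≤ n →
        (ori t M n = true → D.EqGeom G φ t M n ∧ (D.hgt t M n).natAbs ≤ 10 * n ∧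
          ∀ (fam : Fin 2) (τ : ℤˣ), 1 - δ ≤ (bondPercolation G p).real (eventN G φ D (t, M, some (n, fam, famSign (qd t M n) fam, τ)))) ∧
        (ori t M n = false → DT.EqGeom G (trφ φ) t M n ∧ (DT.hgt t M n).natAbs ≤ 10 * n ∧
          ∀ (fam : Fin 2) (τ : ℤˣ), 1 - δ ≤ (bondPercolation G p).real (eventN G (trφ φ) DT (t, M, some (n, fam, famSign (qdT t M n) fam, τ))))) := by
  set μ := bondPercolation G p with hμ
  -- one seed level for all base vertices
  obtain ⟨k, hkm, hk⟩ := exists_seed_scale hfr hC hκ hθ (η := (δ / 2) ^ 32) (by positivity) (max m₀ 1)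
  have hk1 : 1 ≤ k := le_trans (le_max_right _ _) hkm
  have hseed : ∀ t ∈ types, 1 - (δ / 2) ^ 32 ≤ μ.real (TwoAxis.SeedPerc (↑(fatSeq hfr hC t k) : Set V)) := fun t ht => by
    have := hk t ht 0; rw [fatSeqOff_zero] at this; exact this.le
  have hδ32 : (δ / 2) ^ 32 < 1 := pow_lt_one₀ (by positivity) (by linarith) (by norm_num)
  -- per-type thresholds, both orientations (no inversion needed)
  have hthr : ∀ t, ∃ (M₀ : ℕ) (n₁ : ℕ → ℕ), t ∈ types → k ≤ M₀ ∧
      (∀ M, M₀ ≤ M → ∀ n, n₁ M ≤ n → ¬ Eq.Good G φ t p ↑(fatSeq hfr hC t k) n 0 (3 * n) →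
        EquilibriumAtWBQ G φ p t (fatSeq hfr hC t k) M (fatRadius hfr hC) δ n) ∧
      (∀ M, M₀ ≤ M → ∀ n, n₁ M ≤ n → ¬ Eq.Good G (trφ φ) t p ↑(fatSeq hfr hC t k) n 0 (3 * n) →
        EquilibriumAtWBQ G (trφ φ) p t (fatSeq hfr hC t k) M (fatRadius hfr hC) δ n) := by
    intro t
    by_cases ht : t ∈ types
    · obtain ⟨M₁, n₁, hkM₁, h₁⟩ := exists_thresholds_of_seedQ_q hc hlip hq hfr hfr hC hC (fun _ _ => rfl) (fun _ _ _ => rfl) (fun _ _ _ _ => rfl)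
        hp0 hp1 hU ht hδ0 hδ1 hk1 (hseed t ht)
      obtain ⟨M₂, n₂, hkM₂, h₂⟩ := exists_thresholds_of_seedQ_q hc (lip_trφ hlip) (QStepsN.trφ hq) (frames_trφ hfr) hfr (cylSubcritical_trφ hC) hC
        (fun t n => cyl_trφ φ t n) (fun t n R => cylBall_trφ t n R) (fun t n R a => cylReach_trφ t n R a) hp0 hp1 hU ht hδ0 hδ1 hk1 (hseed t ht)
      refine ⟨max M₁ M₂, fun M => max (n₁ M) (n₂ M), fun _ => ⟨hkM₁.trans (le_max_left _ _), fun M hM n hn hng => ?_, fun M hM n hn hng => ?_⟩⟩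
      · exact h₁ M (le_trans (le_max_left _ _) hM) n (le_trans (le_max_left _ _) hn) hng
      · exact h₂ M (le_trans (le_max_right _ _) hM) n (le_trans (le_max_right _ _) hn) hng
    · exact ⟨0, fun _ => 0, fun h => absurd h ht⟩
  choose M₀ n₁ hthr using hthr
  -- per-type zone thresholds
  have hzone : ∀ t, ∃ Mz : ℕ, t ∈ types → ∀ M, Mz ≤ M → 1 - δ < μ.real (UniqZone.zone G (fatSeq hfr hC t) k M) := by
    intro t
    by_cases ht : t ∈ types
    · obtain ⟨Mz, hMz⟩ := UniqZone.exists_forall_le_lt_real_zone p hU (fatSeq_nest hlip hfr hC t) (fatSeq_monotone hfr hC t)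
        (fatSeq_exhaust hκ hfr hC ht) k hδ0
      exact ⟨Mz, fun _ => hMz⟩
    · exact ⟨0, fun h => absurd h ht⟩
  choose Mz hMz using hzone
  -- the records
  set MM : ℕ := types.sup M₀ + types.sup Mz + k with hMM
  set NN : ℕ → ℕ := fun M => (types.sup fun t => n₁ t M) + M + 1 with hNN
  set T : V → ℕ → ℕ → ℤ × ℤ × ℤ × ℕ × ℤ := eqQuintBQ G φ p (fun t => fatSeq hfr hC t k) (fatRadius hfr hC) δ with hT
  set TT : V → ℕ → ℕ → ℤ × ℤ × ℤ × ℕ × ℤ := eqQuintBQ G (trφ φ) p (fun t => fatSeq hfr hC t k) (fatRadius hfr hC) δ with hTT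
  set D : DataN V := ⟨fatSeq hfr hC, k, fatRadius hfr hC, MM, NN, fun t M n => (T t M n).2.2.1, fun t M n => (T t M n).2.2.2.1,
    fun t M n => (T t M n).2.2.2.2⟩ with hD
  set DT : DataN V := ⟨fatSeq hfr hC, k, fatRadius hfr hC, MM, NN, fun t M n => (TT t M n).2.2.1, fun t M n => (TT t M n).2.2.2.1,
    fun t M n => (TT t M n).2.2.2.2⟩ with hDT
  set qd : V → ℕ → ℕ → ℤˣ × ℤˣ := fun t M n => (sgnU (T t M n).1, sgnU (T t M n).2.1) with hqd
  set qdT : V → ℕ → ℕ → ℤˣ × ℤˣ := fun t M n => (sgnU (TT t M n).1, sgnU (TT t M n).2.1) with hqdT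
  set ori : V → ℕ → ℕ → Bool := fun t M n => decide (¬ Eq.Good G φ t p ↑(fatSeq hfr hC t k) n 0 (3 * n)) with hori
  refine ⟨D, DT, qd, qdT, ori, le_trans (le_max_left _ _) hkm, hk1, Nat.le_add_left _ _, rfl, rfl, rfl, rfl, rfl, rfl, rfl, fun t ht M hM => ?_,
    fun t ht M hM n hn => ?_⟩
  · rw [eventN_none]
    exact hMz t ht M (le_trans (le_trans (Finset.le_sup (f := Mz) ht) (Nat.le_add_left _ _)) (le_trans (Nat.le_add_right _ _) hM))
  · have hM' : M₀ t ≤ M := le_trans (le_trans (Finset.le_sup (f := M₀) ht) (Nat.le_add_right _ _)) (le_trans (Nat.le_add_right _ _) hM)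
    have hn' : n₁ t M ≤ n := le_trans (le_trans (Finset.le_sup (f := fun t => n₁ t M) ht) (Nat.le_add_right _ _)) (le_trans (Nat.le_add_right _ _) hn)
    have hMn : M < n := by have : NN M ≤ n := hn; simp only [hNN] at this; omega
    have hn1 : 1 ≤ n := by omega
    have hkM : k ≤ M := le_trans (Nat.le_add_left _ _) hM
    -- the orientation lemma at `(t, M, n)`
    have hSM : (↑(fatSeq hfr hC t k) : Set V) ⊆ cyl φ t M := (fatSeq_subset_cyl hfr hC t k).trans (cyl_mono φ t hkM)
    have hSR : (↑(fatSeq hfr hC t k) : Set V) ⊆ cylBall G φ t (pgScale n 0 (3 * n)) (fatRadius hfr hC k) := fun v hv =>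
      cylBall_mono G φ t (le_trans (by omega : k ≤ n) (le_max_left _ _)) le_rfl ((mem_fatSeq_iff hfr hC).1 (Finset.mem_coe.1 hv))
    have hperc : 0 < μ.real (TwoAxis.SeedPerc (↑(fatSeq hfr hC t k) : Set V)) := lt_of_lt_of_le (by linarith) (hseed t ht)
    have hor := Eq.orientation' (t := t) hlip hfr hC hp1 hn1 (fatSeq hfr hC t k) hMn hSM hSR hperc
    constructor
    · intro hot
      have hng : ¬ Eq.Good G φ t p ↑(fatSeq hfr hC t k) n 0 (3 * n) := by simpa [hori] using hot
      have H := (hthr t ht).2.1 M hM' n hn' hng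
      exact eqQuintBQ_spec (Λ := fatSeq hfr hC) (M₀ := MM) (n₁ := NN) H
    · intro hof
      have hg : Eq.Good G φ t p ↑(fatSeq hfr hC t k) n 0 (3 * n) := by simpa [hori] using hof
      have hng : ¬ Eq.Good G (trφ φ) t p ↑(fatSeq hfr hC t k) n 0 (3 * n) := hor.resolve_left (not_not.2 hg)
      have H := (hthr t ht).2.2 M hM' n hn' hng
      exact eqQuintBQ_spec (Λ := fatSeq hfr hC) (M₀ := MM) (n₁ := NN) H

end StepI

end Skelφ

end Summit.CriticalPhenomena.PercolationContinuityZ3.Theorems.Transplant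

end
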